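import Literature.MathematicalPhysics.QuantumFieldTheory.Balaban1983to89.B3Ineq314Local

/-!
# `Balaban1983to89.B3Ineq314Cubes` — T. Bałaban, *(Higgs)₂,₃ quantum fields in a finite volume. III. Renormalization*, Commun. Math.
Phys. **88** (1983) 411–445 [Balaban1983Higgs3], p. 436 [PDF 26]: the estimates **(3.13)/(3.14)** of the generalized expression (3.12) IN
THEIR PRINTED, CUBE-LOCALIZED FORM `Σ_{Δ(v),Δ(v′)} sup_{x∈Δ(v)}|φ(x)| (L^{j₁}η)^{2d} …`, PROVED from the pointwise theorems of p20 gens 2 and 4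
by a cube partition of the torus (the sibling `B3Ineq326CurlyCubes` does the same for the last curly bracket of (3.26) p. 440)

statement-level skeleton of published theorems with citation tags; proofs where landed; nothing here is a claim about the Yang–Mills mass gap

PDF held: `paper:balaban1983-higgs-2-3-quantum-fields-finite-volume` (journal page = PDF page + 410); p. 436 [PDF 26] read on the render
`run/shared/lean/pub/pub-balaban/b2b-balaban-ref1/pages/1983-cmp88-higgs23-III/1983-cmp88-higgs23-III-p026-x2.png`.

CITATION HEADER (lean-in-tree rule).  Part of the lit-balaban TYPED SKELETON (HOME `run/shared/lean/pub/lit-balaban/`), PHASE 2, seat p20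
generation 5; companion of `B3Ineq313Pointwise` (p20 g2: `term312` = (3.12), `abs_term312_le` = (3.13)/(3.14) pointwise), `B3Ineq314Local`
(p20 g4: `abs_term312_le_local`, the localized leg bound of (3.14)).  WHAT IS REPRODUCED: row **B3.Eq3.11-3.17** of
`HOME/lit-balaban-r15/ROWS-B3.md` (fold owner r15), cell item *"the cube-localized estimates (3.13)–(3.14) as printed … not typed"*.

THE PRINTED TEXT (verbatim, p. 436).  *"To make the above statements about the degree quite clear let us show how this expression will
be estimated. We localize additionally the vertices in cubes Δ(v), Δ(v′), |Δ(v)| = |Δ(v′)| = (L^{j₁}η)^d, j₁ = min{j, j′}, and we have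
(the expression (3.12)) ≦ O(1) Σ_{Δ(v),Δ(v′)} sup_{x∈Δ(v)} |φ(x)| (L^{j₁}η)^{2d} (L^jη)^{−d} e^{−δ₀(L^jη)^{−1}dist(Δ(v),Δ(v′))} (L^{j′}η)^{−d+2}
e^{−δ₀(L^{j′}η)^{−1}dist(Δ(v),Δ(v′))} · ((L^{j₁}η)^{−1}dist(Δ(v),Δ(v′)))^{1+α} · (L^{j₁}η)^{1+α} sup_{x∈Δ(v),x′∈Δ(v′)} sup_{y∈Γ_{x,x′},μ}
|(∂^η_μφ′)(y) − (∂^η_μφ′)(x)| / |y − x|^α. (3.13)  We can estimate the factor ((L^{j₁}η)^{−1}dist(Δ(v),Δ(v′)))^{1+α} by O(1) using half of the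
exponential factor with index j₁. If φ′ is a leg of a propagator with an index j″, whose second leg is localized in Δ(v″), then the last
supremum in (3.13) can be estimated by O(1)(L^{j″}η)^{−d+1−α} sup_{x∈Δ(v),x′∈Δ(v′)} exp[−δ₀(L^{j″}η)^{−1}dist(Γ_{x,x′},Δ(v″))], and the
exponential factor together with another exponential factor in (3.13) give us the estimate
(the expression (3.12)) ≦ O(1) Σ_{Δ(v),Δ(v′)} sup_{x∈Δ(v)}|φ(x)| (L^{j₁}η)^{2d} (L^jη)^{−d} exp[−½δ₀(L^jη)^{−1}dist(Δ(v),Δ(v′))] (L^{j′}η)^{−d+2}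
exp[−½δ₀(L^{j′}η)^{−1}dist(Δ(v),Δ(v′))] · (L^{j₁}η)^{1+α}(L^{j″}η)^{−d+1−α} exp[−½δ₀(L^{j″}η)^{−1}dist(Δ(v),Δ(v″))] (there may be an additional
negative power of L^{j″}η coming from differentiations in the vertex v″). (3.14)"*

WHAT IS TYPED / PROVED, and how.  §1 THE CUBES: on the torus `Site P j = (ZMod N)^d` the cube of side `M` lattice steps (`M·η` in
length units; the paper's `M = L^{j₁}`) containing `x` is labelled by `cubeIdx M x = (⌊x_μ/M⌋)_μ` (representatives `x_μ ∈ [0,N)`); `cubes P j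
M` = the set of labels, `fiber M c` = the lattice points of the cube `c`; `card_fiber_le`: a cube has at most `M^d` points (equality needs
`M ∣ N`, not used: every printed statement is an upper bound); `cdist` = the lattice distance of two cubes (least `ℓ¹` torus distance of a
pair of their points; the paper's `dist(Δ(v),Δ(v′))`, η-units), `cdist_le_tdist`; `supOn` = the supremum over a finite set (`0` if empty).
§2 THE LOCALIZATION STEP `sum_sum_le_cubes` (the only mechanism of the sentence *"We localize additionally the vertices in cubes"*): for
`f ≥ 0` and a two-point weight `0 ≤ w(x,x′) ≤ W(Δ(x),Δ(x′))`,
`Σ_{x,x′} η^{2d} f(x)w(x,x′) ≤ Σ_{Δ,Δ′} (Mη)^{2d} sup_{x∈Δ} f(x) · W(Δ,Δ′)` — the volume factor `Σ_{x∈Δ(v),x′∈Δ(v′)} η^{2d} ≤ (L^{j₁}η)^{2d}`.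
§3 **(3.14) AS PRINTED** `abs_term312_le_local_cubes`: p20 g4's pointwise `abs_term312_le_local` localized —
`|(3.12)| ≤ K·(m·m^α)·Σ_{Δ,Δ′∈cubes}(Mη)^{2d} sup_{x∈Δ}‖φ(x)‖·s^{−d}e^{−½δ·dist(Δ,Δ′)/s}·s′^{2−d}e^{−½δ·dist(Δ,Δ′)/s′}·e^{−½δ·dist(Δ,Δ″)/s″}`
with `Δ″` the cube (of any side `M″`) of the second leg `x″` of the propagator `G_{(j″)}`, `m = min(s,s′) = L^{j₁}η`, `K = 8dC₁C₂C₃Q²e^{δ/2}(2/δ+8/δ²)`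
(`C₃` standing for the printed `O(1)(L^{j″}η)^{−d+1−α}`): every printed factor of (3.14), `δ₀ = δ`, for EVERY cube side `M ≥ 1` (the
print takes `M = L^{j₁}`).  **(3.13) in cube form** `abs_term312_le_cubes`: p20 g2's `abs_term312_le` localized the same way (global Hölder
constant `H` of the leg in place of the printed local Hölder supremum — which is ≤ `H`; the printed middle factor
`((L^{j₁}η)^{−1}dist(Δ(v),Δ(v′)))^{1+α}` is the located slip GAPS G-B3-07 and is already absorbed by the half exponentials, as the print says
in the next sentence).  The kernel bounds remain HYPOTHESES (rows B3.Eq2.10–2.12; model instances: p03's `B3Ineq210ZeroBox/…ZeroTorus`).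
D-0026: no named fact; the `def`s are the cube bookkeeping with bodies; standard axioms.  Unit `lit-balaban-p20`
(literature-prover-lit-balaban-p20-g5-0), 2026-08-21.
-/

open scoped BigOperators

namespace Literature.MathematicalPhysics.QuantumFieldTheory.Balaban1983to89.B3Ineq314Cubes

open LatticeFieldCalculus B3Sect3ScalarSelfEnergy B3Taylor310Remainder B3Ineq313Pointwise B3Ineq314Local

noncomputable section

/-! ## 1. Cubes of the torus `T^{(j)}_η` and the supremum over a finite set -/

section Cubes

variable {P : Params} {j : ℕ}

/-- p. 436 [PDF 26], *"We localize additionally the vertices in cubes Δ(v), Δ(v′), |Δ(v)| = |Δ(v′)| = (L^{j₁}η)^d"*: the label of the cube of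
side `M` lattice steps containing the site `x` — coordinatewise `⌊x_μ / M⌋` on the representatives `x_μ ∈ {0, …, N−1}` (the paper: `M = L^{j₁}`).
[cite: Balaban1983Higgs3, (3.13) p.436] -/
def cubeIdx (M : ℕ) (x : Site P j) : Fin P.d → ℕ := fun μ => (x μ).val / M

variable (P j) in
/-- The set of cube labels `{Δ(v)}` of side `M` of the torus `T^{(j)}` (the range of the localization sums `Σ_{Δ(v)}` of (3.13)).
[cite: Balaban1983Higgs3, (3.13) p.436] -/
def cubes (M : ℕ) : Finset (Fin P.d → ℕ) := (Finset.univ : Finset (Site P j)).image (cubeIdx M)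

/-- The lattice points of the cube `Δ` with label `c` (`x ∈ Δ(v)` of (3.13)). [cite: Balaban1983Higgs3, (3.13) p.436] -/
def fiber (M : ℕ) (c : Fin P.d → ℕ) : Finset (Site P j) := Finset.univ.filter fun x => cubeIdx M x = c

/-- Membership in a cube is having its label. [cite: Balaban1983Higgs3, (3.13) p.436] -/
@[simp] theorem mem_fiber {M : ℕ} {c : Fin P.d → ℕ} {x : Site P j} : x ∈ (fiber M c : Finset (Site P j)) ↔ cubeIdx M x = c := by
  simp [fiber]

/-- Every site lies in its own cube. [cite: Balaban1983Higgs3, (3.13) p.436] -/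
theorem mem_fiber_self (M : ℕ) (x : Site P j) : x ∈ (fiber M (cubeIdx M x) : Finset (Site P j)) :=
  mem_fiber.mpr rfl

/-- The label of a site is a cube label. [cite: Balaban1983Higgs3, (3.13) p.436] -/
theorem cubeIdx_mem_cubes (M : ℕ) (x : Site P j) : cubeIdx M x ∈ cubes P j M :=
  Finset.mem_image_of_mem _ (Finset.mem_univ x)

/-- A cube label has a nonempty cube. [cite: Balaban1983Higgs3, (3.13) p.436] -/
theorem fiber_nonempty {M : ℕ} {c : Fin P.d → ℕ} (hc : c ∈ cubes P j M) : (fiber M c : Finset (Site P j)).Nonempty := by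
  obtain ⟨x, -, rfl⟩ := Finset.mem_image.mp hc
  exact ⟨x, mem_fiber_self M x⟩

/-- *"|Δ(v)| = (L^{j₁}η)^d"* as a count of lattice points, in the direction used: a cube of side `M` has AT MOST `M^d` points (equality when
`M` divides the period). [cite: Balaban1983Higgs3, (3.13) p.436] -/
theorem card_fiber_le {M : ℕ} (hM : 0 < M) (c : Fin P.d → ℕ) : (fiber M c : Finset (Site P j)).card ≤ M ^ P.d := by
  classical
  -- the remainders `x_μ mod M` separate the points of one cube
  let g : Site P j → (Fin P.d → ℕ) := fun x μ => (x μ).val % M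
  have hmaps : ∀ x ∈ (fiber M c : Finset (Site P j)), g x ∈ Fintype.piFinset fun _ : Fin P.d => Finset.range M := by
    intro x _
    exact Fintype.mem_piFinset.mpr fun μ => Finset.mem_range.mpr (Nat.mod_lt _ hM)
  have hinj : Set.InjOn g (fiber M c : Finset (Site P j)) := by
    intro x hx y hy hxy
    have hx' : cubeIdx M x = c := mem_fiber.mp hx
    have hy' : cubeIdx M y = c := mem_fiber.mp hy
    funext μ
    apply ZMod.val_injective
    have hq : (x μ).val / M = (y μ).val / M := by
      have h1 : (x μ).val / M = c μ := congrFun hx' μ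
      have h2 : (y μ).val / M = c μ := congrFun hy' μ
      rw [h1, h2]
    have hr : (x μ).val % M = (y μ).val % M := congrFun hxy μ
    calc (x μ).val = M * ((x μ).val / M) + (x μ).val % M := (Nat.div_add_mod _ _).symm
      _ = M * ((y μ).val / M) + (y μ).val % M := by rw [hq, hr]
      _ = (y μ).val := Nat.div_add_mod _ _
  calc (fiber M c : Finset (Site P j)).card ≤ (Fintype.piFinset fun _ : Fin P.d => Finset.range M).card :=
        Finset.card_le_card_of_injOn g hmaps hinj
    _ = M ^ P.d := by rw [Fintype.card_piFinset, Finset.prod_const, Finset.card_range, Finset.card_univ, Fintype.card_fin]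

variable (P j) in
/-- `dist(Δ(v), Δ(v′))` of (3.13)/(3.14) in lattice steps: the least `ℓ¹` torus distance between a point of the cube `c` (side `M`) and a point
of the cube `c′` (side `M′`; the third cube `Δ(v″)` of (3.14) has its own size); `0` for an empty label. [cite: Balaban1983Higgs3, (3.14) p.436] -/
def cdist (M M' : ℕ) (c c' : Fin P.d → ℕ) : ℕ :=
  sInf {n : ℕ | ∃ x x' : Site P j, cubeIdx M x = c ∧ cubeIdx M' x' = c' ∧ Site.tdist x x' = n}

/-- The distance of two cubes is at most the distance of any two of their points (`|x − x′| ≥ dist(Δ(v),Δ(v′))` for `x ∈ Δ(v)`, `x′ ∈ Δ(v′)`).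
[cite: Balaban1983Higgs3, (3.14) p.436] -/
theorem cdist_le_tdist (M M' : ℕ) (x x' : Site P j) : cdist P j M M' (cubeIdx M x) (cubeIdx M' x') ≤ Site.tdist x x' :=
  Nat.sInf_le ⟨x, x', rfl, rfl, rfl⟩

/-- kernel: the decay factors are monotone under `|x − x′| ↦ dist(Δ,Δ′)`: `e^{−a·η|x−x′|} ≤ e^{−a·η·dist(Δ(x),Δ′(x′))}` (`a, η ≥ 0`).
[cite: Balaban1983Higgs3, (3.14) p.436] -/
theorem exp_tdist_le_exp_cdist {a η : ℝ} (ha : 0 ≤ a) (hη : 0 ≤ η) (M M' : ℕ) (x x' : Site P j) :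
    Real.exp (-(a * (η * Site.tdist x x'))) ≤ Real.exp (-(a * (η * (cdist P j M M' (cubeIdx M x) (cubeIdx M' x') : ℝ)))) := by
  rw [Real.exp_le_exp, neg_le_neg_iff]
  have h : (cdist P j M M' (cubeIdx M x) (cubeIdx M' x') : ℝ) ≤ Site.tdist x x' := by exact_mod_cast cdist_le_tdist M M' x x'
  exact mul_le_mul_of_nonneg_left (mul_le_mul_of_nonneg_left h hη) ha

end Cubes

section SupOn

variable {α : Type*}

/-- `sup_{x∈Δ} f(x)` over a finite set (the printed `sup_{x∈Δ(v)}|φ(x)|` of (3.13)); `0` on the empty set. [cite: Balaban1983Higgs3, (3.13) p.436] -/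
def supOn (s : Finset α) (f : α → ℝ) : ℝ := if h : s.Nonempty then s.sup' h f else 0

/-- Each value is below the supremum (`|φ(x)| ≤ sup_{x∈Δ(v)}|φ(x)|` for `x ∈ Δ(v)`). [cite: Balaban1983Higgs3, (3.13) p.436] -/
theorem le_supOn {s : Finset α} (f : α → ℝ) {x : α} (hx : x ∈ s) : f x ≤ supOn s f := by
  unfold supOn
  rw [dif_pos ⟨x, hx⟩]
  exact Finset.le_sup' f hx

/-- The supremum `sup_{x∈Δ(v)}` is below any nonnegative common bound. [cite: Balaban1983Higgs3, (3.13) p.436] -/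
theorem supOn_le {s : Finset α} {f : α → ℝ} {B : ℝ} (hB : 0 ≤ B) (h : ∀ x ∈ s, f x ≤ B) : supOn s f ≤ B := by
  unfold supOn
  split_ifs with hs
  · exact Finset.sup'_le hs f h
  · exact hB

/-- The supremum `sup_{x∈Δ(v)}` of a nonnegative function is nonnegative. [cite: Balaban1983Higgs3, (3.13) p.436] -/
theorem supOn_nonneg {s : Finset α} {f : α → ℝ} (hf : ∀ x ∈ s, 0 ≤ f x) : 0 ≤ supOn s f := by
  unfold supOn
  split_ifs with hs
  · obtain ⟨x, hx⟩ := hs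
    exact (hf x hx).trans (Finset.le_sup' f hx)
  · exact le_rfl

end SupOn

/-! ## 2. The localization step: `Σ_{x,x′} η^{2d} → Σ_{Δ(v),Δ(v′)} (L^{j₁}η)^{2d} sup` -/

section Localization

variable {P : Params} {j : ℕ}

/-- kernel: the volume sum resolved along the cubes, `Σ_x F(x) = Σ_{Δ} Σ_{x∈Δ} F(x)`. [cite: Balaban1983Higgs3, (3.13) p.436] -/
theorem sum_eq_sum_cubes (M : ℕ) (F : Site P j → ℝ) :
    ∑ x : Site P j, F x = ∑ c ∈ cubes P j M, ∑ x ∈ (fiber M c : Finset (Site P j)), F x := by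
  classical
  unfold fiber
  rw [Finset.sum_fiberwise_of_maps_to (fun x _ => cubeIdx_mem_cubes M x)]

/-- p. 436 [PDF 26], the mechanism of *"We localize additionally the vertices in cubes Δ(v), Δ(v′), |Δ(v)| = |Δ(v′)| = (L^{j₁}η)^d … (the
expression (3.12)) ≦ O(1) Σ_{Δ(v),Δ(v′)} sup_{x∈Δ(v)}|φ(x)| (L^{j₁}η)^{2d} …"* — PROVED for every cube side `M ≥ 1`: if `f ≥ 0` and the
two-point weight satisfies `0 ≤ w(x,x′) ≤ W(Δ(x),Δ(x′))` (a function of the cubes only, e.g. of `dist(Δ,Δ′)`), then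
`Σ_{x,x′} η^{2d} f(x)w(x,x′) ≤ Σ_{Δ,Δ′} (Mη)^{2d} (sup_{x∈Δ} f)·W(Δ,Δ′)`. [cite: Balaban1983Higgs3, (3.13) p.436] -/
theorem sum_sum_le_cubes {M : ℕ} (hM : 0 < M) {η : ℝ} (hη : 0 ≤ η) (f : Site P j → ℝ) (hf : ∀ x, 0 ≤ f x)
    (w : Site P j → Site P j → ℝ) (hw0 : ∀ x x', 0 ≤ w x x') (W : (Fin P.d → ℕ) → (Fin P.d → ℕ) → ℝ)
    (hw : ∀ x x', w x x' ≤ W (cubeIdx M x) (cubeIdx M x')) :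
    ∑ x : Site P j, ∑ x' : Site P j, η ^ (2 * P.d) * (f x * w x x') ≤
      ∑ c ∈ cubes P j M, ∑ c' ∈ cubes P j M,
        ((M : ℝ) * η) ^ (2 * P.d) * (supOn (fiber M c : Finset (Site P j)) f * W c c') := by
  classical
  -- resolve both volume sums along the cubes and exchange the middle two
  have hres : ∑ x : Site P j, ∑ x' : Site P j, η ^ (2 * P.d) * (f x * w x x') =
      ∑ c ∈ cubes P j M, ∑ c' ∈ cubes P j M, ∑ x ∈ (fiber M c : Finset (Site P j)), ∑ x' ∈ (fiber M c' : Finset (Site P j)),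
        η ^ (2 * P.d) * (f x * w x x') := by
    rw [sum_eq_sum_cubes M]
    refine Finset.sum_congr rfl fun c _ => ?_
    rw [Finset.sum_congr rfl fun x _ => sum_eq_sum_cubes M (fun x' => η ^ (2 * P.d) * (f x * w x x')), Finset.sum_comm]
  rw [hres]
  refine Finset.sum_le_sum fun c hc => Finset.sum_le_sum fun c' hc' => ?_
  -- inside one pair of cubes: each term is below `η^{2d}·(sup f)·W`, and there are at most `M^d·M^d` terms
  set S : ℝ := supOn (fiber M c : Finset (Site P j)) f with hS
  have hS0 : 0 ≤ S := supOn_nonneg fun x _ => hf x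
  have hterm : ∀ x ∈ (fiber M c : Finset (Site P j)), ∀ x' ∈ (fiber M c' : Finset (Site P j)),
      η ^ (2 * P.d) * (f x * w x x') ≤ η ^ (2 * P.d) * (S * W c c') := by
    intro x hx x' hx'
    have hcx : cubeIdx M x = c := mem_fiber.mp hx
    have hcx' : cubeIdx M x' = c' := mem_fiber.mp hx'
    have h1 : f x ≤ S := le_supOn f hx
    have h2 : w x x' ≤ W c c' := by rw [← hcx, ← hcx']; exact hw x x'
    exact mul_le_mul_of_nonneg_left (mul_le_mul h1 h2 (hw0 x x') hS0) (pow_nonneg hη _)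
  obtain ⟨x₀, hx₀⟩ := fiber_nonempty hc
  obtain ⟨x₀', hx₀'⟩ := fiber_nonempty hc'
  have hB0 : 0 ≤ η ^ (2 * P.d) * (S * W c c') :=
    (mul_nonneg (pow_nonneg hη _) (mul_nonneg (hf x₀) (hw0 x₀ x₀'))).trans (hterm x₀ hx₀ x₀' hx₀')
  have hcard : ((fiber M c : Finset (Site P j)).card : ℝ) ≤ (M : ℝ) ^ P.d := by exact_mod_cast card_fiber_le hM c
  have hcard' : ((fiber M c' : Finset (Site P j)).card : ℝ) ≤ (M : ℝ) ^ P.d := by exact_mod_cast card_fiber_le hM c'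
  calc ∑ x ∈ (fiber M c : Finset (Site P j)), ∑ x' ∈ (fiber M c' : Finset (Site P j)), η ^ (2 * P.d) * (f x * w x x')
      ≤ ∑ x ∈ (fiber M c : Finset (Site P j)), ∑ x' ∈ (fiber M c' : Finset (Site P j)), η ^ (2 * P.d) * (S * W c c') :=
        Finset.sum_le_sum fun x hx => Finset.sum_le_sum fun x' hx' => hterm x hx x' hx'
    _ = ((fiber M c : Finset (Site P j)).card : ℝ) * (((fiber M c' : Finset (Site P j)).card : ℝ) *
          (η ^ (2 * P.d) * (S * W c c'))) := by
        simp only [Finset.sum_const, nsmul_eq_mul]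
    _ ≤ (M : ℝ) ^ P.d * ((M : ℝ) ^ P.d * (η ^ (2 * P.d) * (S * W c c'))) := by gcongr
    _ = ((M : ℝ) * η) ^ (2 * P.d) * (S * W c c') := by ring

end Localization

/-! ## 3. (3.13) and (3.14) in the printed cube-localized form -/

section Ineq314

variable {P : Params} {j : ℕ} {W : Type*} [NormedAddCommGroup W] [InnerProductSpace ℝ W]

/-- kernel: a constant dominating an absolute value through two positive factors is nonnegative. [folklore] -/
private theorem nonneg_of_abs_le_mul_mul {v C p e : ℝ} (h : |v| ≤ C * p * e) (hp : 0 < p) (he : 0 < e) : 0 ≤ C :=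
  nonneg_of_mul_nonneg_left (nonneg_of_mul_nonneg_left ((abs_nonneg v).trans h) he) hp

/-- **(3.13)** p. 436 [PDF 26] in its printed CUBE-LOCALIZED form, PROVED (for every cube side `M ≥ 1`; the print: `M = L^{j₁}`, `Mη = L^{j₁}η`):
under the hypotheses of `B3Ineq313Pointwise.abs_term312_le` ((2.10)-type bounds on the two kernels at scales `s = L^jη`, `s′ = L^{j′}η`,
`|g|,|g′| ≤ 1`, `‖qw‖ ≤ Q‖w‖`, a Hölder-`α` leg `φ′` with constant `H`),
`|(3.12)| ≤ 2dC₁C₂Q²H(2/δ+8/δ²)·(m·m^α)·Σ_{Δ,Δ′} (Mη)^{2d} sup_{x∈Δ}‖φ(x)‖·s^{−d}e^{−½δ·η dist(Δ,Δ′)/s}·s′^{2−d}e^{−½δ·η dist(Δ,Δ′)/s′}`,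
`m = min(s,s′) = L^{j₁}η` — the displayed `Σ_{Δ(v),Δ(v′)} sup_{x∈Δ(v)}|φ(x)|(L^{j₁}η)^{2d}(L^jη)^{−d}e^{…}(L^{j′}η)^{−d+2}e^{…}(L^{j₁}η)^{1+α}·[Hölder sup]`
with `δ₀ = ½δ` (the half exponentials already spent on the factor `((L^{j₁}η)^{−1}dist(Δ(v),Δ(v′)))^{1+α}`, as the sentence after (3.13) says;
that factor itself is the located slip GAPS G-B3-07 and is not reproduced) and the global Hölder constant `H ≥` the printed local supremum.
[cite: Balaban1983Higgs3, (3.13) p.436] -/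
theorem abs_term312_le_cubes (η : ℝ) (hη : 0 < η) {α H Q C₁ C₂ δ s s' : ℝ} (hα0 : 0 ≤ α) (hα1 : α ≤ 1) (hH : 0 ≤ H) (hQ : 0 ≤ Q)
    (hδ : 0 < δ) (hs : 0 < s) (hs' : 0 < s') (q : W →ₗ[ℝ] W) (hq : ∀ w : W, ‖q w‖ ≤ Q * ‖w‖)
    (Gj Gj' : Kernel P j) (g g' : SiteField P j ℝ) (hg : ∀ x, |g x| ≤ 1) (hg' : ∀ x, |g' x| ≤ 1)
    (hGj : ∀ (μ : Fin P.d) (x x' : Site P j),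
      |dKernel η⁻¹ μ Gj x x'| ≤ C₁ * s ^ (-(P.d : ℝ)) * Real.exp (-(δ * s⁻¹ * (η * Site.tdist x x'))))
    (hGj' : ∀ x x' : Site P j,
      |Gj' x x'| ≤ C₂ * s' ^ (2 - (P.d : ℝ)) * Real.exp (-(δ * s'⁻¹ * (η * Site.tdist x x'))))
    (φ φ' : SiteField P j W) (hφ' : HolderDeriv η⁻¹ α H φ') {M : ℕ} (hM : 0 < M) :
    |term312 η q Gj Gj' g g' φ φ'| ≤
      2 * P.d * C₁ * C₂ * Q ^ 2 * H * (2 / δ + 8 / δ ^ 2) * (min s s' * (min s s') ^ α) *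
        ∑ c ∈ cubes P j M, ∑ c' ∈ cubes P j M, ((M : ℝ) * η) ^ (2 * P.d) *
          (supOn (fiber M c : Finset (Site P j)) (fun x => ‖φ x‖) *
            ((s ^ (-(P.d : ℝ)) * Real.exp (-(δ / 2 * s⁻¹ * (η * (cdist P j M M c c' : ℝ))))) *
              (s' ^ (2 - (P.d : ℝ)) * Real.exp (-(δ / 2 * s'⁻¹ * (η * (cdist P j M M c c' : ℝ))))))) := by
  have hpt := abs_term312_le η hη hα0 hα1 hH hQ hδ hs hs' q hq Gj Gj' g g' hg hg' hGj hGj' φ φ' hφ'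
  have hC₁ : 0 ≤ C₁ :=
    nonneg_of_abs_le_mul_mul (hGj ⟨0, P.hd⟩ default default) (Real.rpow_pos_of_pos hs _) (Real.exp_pos _)
  have hC₂ : 0 ≤ C₂ := nonneg_of_abs_le_mul_mul (hGj' default default) (Real.rpow_pos_of_pos hs' _) (Real.exp_pos _)
  have hm : 0 < min s s' := lt_min hs hs'
  have hK : 0 ≤ 2 * P.d * C₁ * C₂ * Q ^ 2 * H * (2 / δ + 8 / δ ^ 2) * (min s s' * (min s s') ^ α) := by positivity
  -- the localization step on the weight of (3.13)
  have hloc := sum_sum_le_cubes hM hη.le (fun x => ‖φ x‖) (fun x => norm_nonneg _)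
    (fun x x' => (s ^ (-(P.d : ℝ)) * Real.exp (-(δ / 2 * s⁻¹ * (η * Site.tdist x x')))) *
      (s' ^ (2 - (P.d : ℝ)) * Real.exp (-(δ / 2 * s'⁻¹ * (η * Site.tdist x x')))))
    (fun x x' => by positivity)
    (fun c c' => (s ^ (-(P.d : ℝ)) * Real.exp (-(δ / 2 * s⁻¹ * (η * (cdist P j M M c c' : ℝ))))) *
      (s' ^ (2 - (P.d : ℝ)) * Real.exp (-(δ / 2 * s'⁻¹ * (η * (cdist P j M M c c' : ℝ))))))
    (fun x x' => mul_le_mul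
      (mul_le_mul_of_nonneg_left (exp_tdist_le_exp_cdist (by positivity) hη.le M M x x') (Real.rpow_pos_of_pos hs _).le)
      (mul_le_mul_of_nonneg_left (exp_tdist_le_exp_cdist (by positivity) hη.le M M x x') (Real.rpow_pos_of_pos hs' _).le)
      (by positivity) (by positivity))
  have hre : (∑ x : Site P j, ∑ x' : Site P j, η ^ (2 * P.d) *
      (‖φ x‖ * (s ^ (-(P.d : ℝ)) * Real.exp (-(δ / 2 * s⁻¹ * (η * Site.tdist x x'))))
        * (s' ^ (2 - (P.d : ℝ)) * Real.exp (-(δ / 2 * s'⁻¹ * (η * Site.tdist x x')))))) =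
      ∑ x : Site P j, ∑ x' : Site P j, η ^ (2 * P.d) *
        (‖φ x‖ * ((s ^ (-(P.d : ℝ)) * Real.exp (-(δ / 2 * s⁻¹ * (η * Site.tdist x x')))) *
          (s' ^ (2 - (P.d : ℝ)) * Real.exp (-(δ / 2 * s'⁻¹ * (η * Site.tdist x x')))))) :=
    Finset.sum_congr rfl fun x _ => Finset.sum_congr rfl fun x' _ => by ring
  rw [hre] at hpt
  exact hpt.trans (mul_le_mul_of_nonneg_left hloc hK)

/-- **(3.14)** p. 436 [PDF 26] AS PRINTED (cube-localized), PROVED for every pair of cube sides `M ≥ 1` (for `Δ(v), Δ(v′)`; the print: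
`M = L^{j₁}`) and `M″ ≥ 1` (for the cube `Δ(v″)` of the second leg `x″` of the propagator `G_{(j″)}` of the leg `φ′`): under the hypotheses of
`B3Ineq314Local.abs_term312_le_local` (the localized (2.11)-type leg bound around `x″`, `C₃` for the printed `O(1)(L^{j″}η)^{−d+1−α}`, `s″ =
L^{j″}η ≥ max(s,s′)`, `η ≤ s″`),
`|(3.12)| ≤ 8dC₁C₂C₃Q²e^{δ/2}(2/δ+8/δ²)·(m·m^α)·Σ_{Δ,Δ′}(Mη)^{2d} sup_{x∈Δ}‖φ(x)‖·s^{−d}e^{−½δ·η dist(Δ,Δ′)/s}·s′^{2−d}e^{−½δ·η dist(Δ,Δ′)/s′}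
·e^{−½δ·η dist(Δ,Δ″)/s″}` — i.e. `O(1) Σ_{Δ(v),Δ(v′)} sup_{x∈Δ(v)}|φ(x)| (L^{j₁}η)^{2d} (L^jη)^{−d} exp[−½δ₀(L^jη)^{−1}dist(Δ(v),Δ(v′))]
(L^{j′}η)^{−d+2} exp[−½δ₀(L^{j′}η)^{−1}dist(Δ(v),Δ(v′))]·(L^{j₁}η)^{1+α}(L^{j″}η)^{−d+1−α} exp[−½δ₀(L^{j″}η)^{−1}dist(Δ(v),Δ(v″))]` with `δ₀ = δ`.
[cite: Balaban1983Higgs3, (3.14) p.436] -/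
theorem abs_term312_le_local_cubes (η : ℝ) (hη : 0 < η) {α Q C₁ C₂ C₃ δ s s' s'' : ℝ} (hα0 : 0 ≤ α) (hα1 : α ≤ 1) (hQ : 0 ≤ Q)
    (hC₃ : 0 ≤ C₃) (hδ : 0 < δ) (hs : 0 < s) (hs' : 0 < s') (hss : max s s' ≤ s'') (hηs'' : η ≤ s'')
    (q : W →ₗ[ℝ] W) (hq : ∀ w : W, ‖q w‖ ≤ Q * ‖w‖)
    (Gj Gj' : Kernel P j) (g g' : SiteField P j ℝ) (hg : ∀ x, |g x| ≤ 1) (hg' : ∀ x, |g' x| ≤ 1)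
    (hGj : ∀ (μ : Fin P.d) (x x' : Site P j),
      |dKernel η⁻¹ μ Gj x x'| ≤ C₁ * s ^ (-(P.d : ℝ)) * Real.exp (-(δ * s⁻¹ * (η * Site.tdist x x'))))
    (hGj' : ∀ x x' : Site P j,
      |Gj' x x'| ≤ C₂ * s' ^ (2 - (P.d : ℝ)) * Real.exp (-(δ * s'⁻¹ * (η * Site.tdist x x'))))
    (φ φ' : SiteField P j W) (x'' : Site P j)
    (hleg : ∀ (μ : Fin P.d) (z z' : Site P j), ‖pdiff η⁻¹ μ φ' z - pdiff η⁻¹ μ φ' z'‖ ≤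
      C₃ * (η * Site.tdist z z') ^ α * Real.exp (-(δ * s''⁻¹ * (η * ((min (Site.tdist z x'') (Site.tdist z' x'') : ℕ) : ℝ)))))
    {M M'' : ℕ} (hM : 0 < M) :
    |term312 η q Gj Gj' g g' φ φ'| ≤
      8 * P.d * C₁ * C₂ * C₃ * Q ^ 2 * Real.exp (δ / 2) * (2 / δ + 8 / δ ^ 2) * (min s s' * (min s s') ^ α) *
        ∑ c ∈ cubes P j M, ∑ c' ∈ cubes P j M, ((M : ℝ) * η) ^ (2 * P.d) *
          (supOn (fiber M c : Finset (Site P j)) (fun x => ‖φ x‖) *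
            ((s ^ (-(P.d : ℝ)) * Real.exp (-(δ / 2 * s⁻¹ * (η * (cdist P j M M c c' : ℝ))))) *
              (s' ^ (2 - (P.d : ℝ)) * Real.exp (-(δ / 2 * s'⁻¹ * (η * (cdist P j M M c c' : ℝ))))) *
              Real.exp (-(δ / 2 * s''⁻¹ * (η * (cdist P j M M'' c (cubeIdx M'' x'') : ℝ)))))) := by
  have hpt := abs_term312_le_local η hη hα0 hα1 hQ hC₃ hδ hs hs' hss hηs'' q hq Gj Gj' g g' hg hg' hGj hGj' φ φ' x'' hleg
  have hs'' : 0 < s'' := lt_of_lt_of_le (lt_max_of_lt_left hs) hss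
  have hC₁ : 0 ≤ C₁ :=
    nonneg_of_abs_le_mul_mul (hGj ⟨0, P.hd⟩ default default) (Real.rpow_pos_of_pos hs _) (Real.exp_pos _)
  have hC₂ : 0 ≤ C₂ := nonneg_of_abs_le_mul_mul (hGj' default default) (Real.rpow_pos_of_pos hs' _) (Real.exp_pos _)
  have hm : 0 < min s s' := lt_min hs hs'
  have hK : 0 ≤ 8 * P.d * C₁ * C₂ * C₃ * Q ^ 2 * Real.exp (δ / 2) * (2 / δ + 8 / δ ^ 2) * (min s s' * (min s s') ^ α) := by
    positivity
  have hloc := sum_sum_le_cubes hM hη.le (fun x => ‖φ x‖) (fun x => norm_nonneg _)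
    (fun x x' => (s ^ (-(P.d : ℝ)) * Real.exp (-(δ / 2 * s⁻¹ * (η * Site.tdist x x')))) *
      (s' ^ (2 - (P.d : ℝ)) * Real.exp (-(δ / 2 * s'⁻¹ * (η * Site.tdist x x')))) *
      Real.exp (-(δ / 2 * s''⁻¹ * (η * Site.tdist x x''))))
    (fun x x' => by positivity)
    (fun c c' => (s ^ (-(P.d : ℝ)) * Real.exp (-(δ / 2 * s⁻¹ * (η * (cdist P j M M c c' : ℝ))))) *
      (s' ^ (2 - (P.d : ℝ)) * Real.exp (-(δ / 2 * s'⁻¹ * (η * (cdist P j M M c c' : ℝ))))) *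
      Real.exp (-(δ / 2 * s''⁻¹ * (η * (cdist P j M M'' c (cubeIdx M'' x'') : ℝ)))))
    (fun x x' => mul_le_mul (mul_le_mul
      (mul_le_mul_of_nonneg_left (exp_tdist_le_exp_cdist (by positivity) hη.le M M x x') (Real.rpow_pos_of_pos hs _).le)
      (mul_le_mul_of_nonneg_left (exp_tdist_le_exp_cdist (by positivity) hη.le M M x x') (Real.rpow_pos_of_pos hs' _).le)
      (by positivity) (by positivity))
      (exp_tdist_le_exp_cdist (by positivity) hη.le M M'' x x'') (by positivity) (by positivity))
  have hre : (∑ x : Site P j, ∑ x' : Site P j, η ^ (2 * P.d) *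
      (‖φ x‖ * (s ^ (-(P.d : ℝ)) * Real.exp (-(δ / 2 * s⁻¹ * (η * Site.tdist x x'))))
        * (s' ^ (2 - (P.d : ℝ)) * Real.exp (-(δ / 2 * s'⁻¹ * (η * Site.tdist x x'))))
        * Real.exp (-(δ / 2 * s''⁻¹ * (η * Site.tdist x x''))))) =
      ∑ x : Site P j, ∑ x' : Site P j, η ^ (2 * P.d) *
        (‖φ x‖ * ((s ^ (-(P.d : ℝ)) * Real.exp (-(δ / 2 * s⁻¹ * (η * Site.tdist x x')))) *
          (s' ^ (2 - (P.d : ℝ)) * Real.exp (-(δ / 2 * s'⁻¹ * (η * Site.tdist x x')))) *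
          Real.exp (-(δ / 2 * s''⁻¹ * (η * Site.tdist x x''))))) :=
    Finset.sum_congr rfl fun x _ => Finset.sum_congr rfl fun x' _ => by ring
  rw [hre] at hpt
  exact hpt.trans (mul_le_mul_of_nonneg_left hloc hK)

end Ineq314

end

end Literature.MathematicalPhysics.QuantumFieldTheory.Balaban1983to89.B3Ineq314Cubes
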